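import Literature.NumberTheory.Sieve.HeathBrownCubicTwistedLocalise
import Literature.NumberTheory.Sieve.HeathBrownCubicTwistedClassISum
import Literature.NumberTheory.Sieve.HeathBrownCubicTwistedUstarBound
import HarnessLib

/-!
# Heath-Brown's Lemma 3.10 for a twisted weight: Lemma 12.2, the bound for `S₄⁺(w)`

D. R. Heath-Brown, *Primes represented by `x³ + 2y³`*, Acta Math. 186 (2001), Lemma 12.2 / §§12–13, for the
twisted weight `w(β̂)F_β`, `w` `d`-periodic with `|w| ≤ 1` (Heath-Brown–Moroz 2004, Prop. 4.2 (ii)): the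
tree's `HeathBrownCubicTypeIIS4Bound` re-run with the twisted Class I / small-`q` inputs (level `d·Q₁`,
constant `d³C₁`). PROVED: the Class II cells `sum_classII_abs_S5_le` (untwisted majorant via Lemma 11.1),
the Class I part for good hypercubes `sum_wt_Ustar_good_le`, and **`abs_S4plus_le`** (twisted; the only change
in the bound is `C₁ ↦ d³C₁`).

## References

* D. R. Heath-Brown, Acta Math. 186 (2001), Lemma 12.2. [cite: HeathBrownActa2001, Lemma 12.2]
* D. R. Heath-Brown, B. Z. Moroz, Proc. London Math. Soc. 88 (2004), Prop. 4.2. [cite: HeathBrownMoroz2004, Proposition 4.2]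

## Mathlib / tree search

Tree: `HeathBrownCubicTypeIIS4Bound` (`S7_le`, `card_classII_le` via `…ClassII`, `cubeCond_of_goodCube`,
`hcf3_le_of_goodCube`, `abs_S4plus_le`), `HeathBrownCubicTypeIIClassISum` (`goodCube`, `wt_nonneg`).
-/

noncomputable section

open Finset NumberField

namespace Literature.NumberTheory.Sieve.CubicSieve.Twisted

open LFunctions.CubeRootTwoField CubicPrimes CubicSieve LargeSieve

variable {X η τ V T : ℝ} {k : ℕ} {m : Fin k → ℕ} {w : ℤ × ℤ × ℤ → ℝ} {N : ℕ} {Δ₀ : ℝ}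

open scoped Classical in
/-- **The Class II cells**: `∑_{Class II cells} |S₅| ≤ #Trange · 3.4·10¹⁰(6N+3)⁵ · 81 · C₁₁s⁶(log s)^E (2/(NΔ₀) + 3/Δ₀²)`.
[cite: HeathBrownActa2001, §12 p. 75] -/
theorem sum_classII_abs_S5_le (hw : ∀ b, |w b| ≤ 1) (hX : 1 < X) (hη0 : 0 ≤ η) (hη1 : η ≤ 1) (hτ : 0 < τ) (hτ1 : τ ≤ 1) {nn : ℕ}
    {m : Fin (nn + 1) → ℕ} (hm : CoreAdmissible τ m) (hT : 0 < T) (hTV : T ^ 3 = V) (hN : 1248 ≤ N)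
    {C₁₁ κ : ℝ} {E : ℕ} (hC₁₁ : 0 < C₁₁)
    (h11 : ∀ (a₁ a₂ : ℝ × ℝ × ℝ) (S₀ : ℝ), 2 ≤ S₀ →
      |a₁.1| ≤ S₀ ^ 3 → |a₁.2.1| ≤ S₀ ^ 3 → |a₁.2.2| ≤ S₀ ^ 3 →
        ∀ D : ℕ, 1 ≤ D → (D : ℝ) ≤ κ * S₀ →
          ∑ b ∈ (latticeCube a₁ S₀).filter IsPrimitiveVec,
              ∑ _x ∈ (latticeCube a₂ S₀).filter (fun x => DvdVec (D : ℤ) (cross3 b x)),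
                (idealDivisorCount (Ideal.span {coordElt b}) : ℝ) ^ 2 ≤
            C₁₁ * S₀ ^ 6 / (D : ℝ) ^ 2 * Real.log S₀ ^ E)
    (hs2 : 2 ≤ T / N) (hsN : 3 * (N : ℝ) + 2 ≤ (T / N) ^ 2) (hκs : 270 * V / X ≤ κ * (T / N))
    (hΔ1 : 1 ≤ Δ₀) (hΔD : Δ₀ ≤ 270 * V / X) :
    ∑ c ∈ (Trange N Δ₀ (270 * V / X) ×ˢ (Nrange N ×ˢ Nrange N)).filter
        (fun c => ¬ ClassI X η T V N c.1 c.2.1 c.2.2 ∧ ¬ Class0 X η T V N c.1 c.2.1 c.2.2),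
        |S5 X η τ m V T w N Δ₀ c| ≤
      ((N : ℝ) * (Real.log (270 * V / X) - Real.log Δ₀) + 2) * (34000000000 * (6 * (N : ℝ) + 3) ^ 5) *
        (81 * (C₁₁ * (T / N) ^ 6 * Real.log (T / N) ^ E * (2 / (N * Δ₀) + 3 / Δ₀ ^ 2))) := by
  classical
  have hX0 : 0 < X := by linarith
  have hN0 : 0 < N := by omega
  have hΔ0 : 0 < Δ₀ := by linarith
  set TR := Trange N Δ₀ (270 * V / X) with hTR
  set NN := Nrange N ×ˢ Nrange N with hNN
  set B7 : ℝ := C₁₁ * (T / N) ^ 6 * Real.log (T / N) ^ E * (2 / (N * Δ₀) + 3 / Δ₀ ^ 2) with hB7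
  have hlog : 0 ≤ Real.log (T / N) := Real.log_nonneg (by linarith)
  have hB70 : 0 ≤ B7 := by
    rw [hB7]; exact mul_nonneg (mul_nonneg (by positivity) (pow_nonneg hlog _)) (by positivity)
  -- per cell
  have hcell : ∀ c ∈ (TR ×ˢ NN).filter (fun c => ¬ ClassI X η T V N c.1 c.2.1 c.2.2 ∧ ¬ Class0 X η T V N c.1 c.2.1 c.2.2),
      |S5 X η τ m V T w N Δ₀ c| ≤ 81 * B7 := by
    intro c hc
    rw [mem_filter, mem_product, hNN, mem_product] at hc
    obtain ⟨⟨-, hn, hn'⟩, -⟩ := hc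
    have h := abs_S5_le_S7 (w := w) hw hX hη1 hτ hτ1 hm hT hTV hN0 (Δ₀ := Δ₀) c.1 c.2.1 c.2.2
    have h7 := S7_le hC₁₁ h11 hN0 hs2 hsN hκs hΔ0 c.1 hn c.2.2
    have h7' := S7_le hC₁₁ h11 hN0 hs2 hsN hκs hΔ0 c.1 hn' c.2.1
    rw [← hB7] at h7 h7'
    have : (c.1, c.2.1, c.2.2) = c := rfl
    rw [this] at h
    linarith
  -- count
  calc ∑ c ∈ (TR ×ˢ NN).filter (fun c => ¬ ClassI X η T V N c.1 c.2.1 c.2.2 ∧ ¬ Class0 X η T V N c.1 c.2.1 c.2.2),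
        |S5 X η τ m V T w N Δ₀ c|
      ≤ ∑ _c ∈ (TR ×ˢ NN).filter (fun c => ¬ ClassI X η T V N c.1 c.2.1 c.2.2 ∧ ¬ Class0 X η T V N c.1 c.2.1 c.2.2),
          81 * B7 := sum_le_sum hcell
    _ = #((TR ×ˢ NN).filter (fun c => ¬ ClassI X η T V N c.1 c.2.1 c.2.2 ∧ ¬ Class0 X η T V N c.1 c.2.1 c.2.2)) * (81 * B7) := by
        rw [sum_const, nsmul_eq_mul]
    _ ≤ (((N : ℝ) * (Real.log (270 * V / X) - Real.log Δ₀) + 2) * (34000000000 * (6 * (N : ℝ) + 3) ^ 5)) * (81 * B7) := by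
        refine mul_le_mul_of_nonneg_right ?_ (by positivity)
        rw [card_filter_prod_eq_sum, Nat.cast_sum]
        calc ∑ t ∈ TR, (#(NN.filter (fun nn => ¬ ClassI X η T V N (t, nn).1 (t, nn).2.1 (t, nn).2.2 ∧
              ¬ Class0 X η T V N (t, nn).1 (t, nn).2.1 (t, nn).2.2)) : ℝ)
            ≤ ∑ _t ∈ TR, (34000000000 * (6 * (N : ℝ) + 3) ^ 5) := by
              refine sum_le_sum fun t _ => ?_
              have := card_classII_le hX0 hη0 hη1 hT hTV hN t
              rw [hNN]; exact this
          _ = #TR * (34000000000 * (6 * (N : ℝ) + 3) ^ 5) := by rw [sum_const, nsmul_eq_mul]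
          _ ≤ _ := by
              gcongr
              exact card_Trange_le hΔ1 hΔD
    _ = _ := by ring

/-! ### The hypercubes of a Class I cell satisfy the conditions of (3.14) -/


/-! ### The Class I part for good hypercubes -/

open scoped Classical in
/-- **`∑_{q ≤ d₀} w(q) U*(C(𝐧), q)` for a good hypercube `𝐧 ∈ Nrange`**, with the per-hypercube divisor sums
bounded by Lemma 4.5 (constants `C₂, e₂` for `τ²`, `C₃, e₃` for `τ³`; `A = 3`, so `|corner| ≤ s³` needs
`3N + 2 ≤ s²`). [cite: HeathBrownActa2001, §13 pp. 81–83] -/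
theorem sum_wt_Ustar_good_le (hX : 1 < X) (hτ : 0 < τ) (hτ1 : τ ≤ 1) {nn : ℕ} {m : Fin (nn + 1) → ℕ}
    (hm : CoreAdmissible τ m) {Q₁ C₁ c₁ : ℝ} {d : ℕ} (hd : 0 < d) (hHyp : Hyp314 X τ m ((d : ℝ) * Q₁) C₁ c₁ 3 1)
    (hw1 : ∀ b, |w b| ≤ 1) (hwper : ∀ b u, DvdVec (d : ℤ) u → w (b + u) = w b) (hT : 0 < T) (hTV : T ^ 3 = V)
    (hN : 0 < N) (hs2 : 2 ≤ T / N) (hsN : 3 * (N : ℝ) + 2 ≤ (T / N) ^ 2) (hsL : hbL X τ ^ 2 ≤ T / N)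
    {C₂ C₃ : ℝ} {e₂ e₃ : ℕ} (hC₃ : 0 < C₃)
    (h45₂ : ∀ (a : ℝ × ℝ × ℝ) (S₀ : ℝ), 2 ≤ S₀ → |a.1| ≤ S₀ ^ 3 → |a.2.1| ≤ S₀ ^ 3 → |a.2.2| ≤ S₀ ^ 3 →
      ∑ v ∈ latticeCube a S₀, (idealDivisorCount (Ideal.span {coordElt v}) : ℝ) ^ 2 ≤ C₂ * S₀ ^ 3 * Real.log S₀ ^ e₂)
    (h45₃ : ∀ (a : ℝ × ℝ × ℝ) (S₀ : ℝ), 2 ≤ S₀ → |a.1| ≤ S₀ ^ 3 → |a.2.1| ≤ S₀ ^ 3 → |a.2.2| ≤ S₀ ^ 3 →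
      ∑ v ∈ latticeCube a S₀, (idealDivisorCount (Ideal.span {coordElt v}) : ℝ) ^ 3 ≤ C₃ * S₀ ^ 3 * Real.log S₀ ^ e₃)
    {Q₀ : ℕ} (hQ₀ : 1 ≤ Q₀) (hQ₀₁ : (Q₀ : ℝ) ≤ Q₁) {Δ₀ : ℝ} (hΔ : 0 < Δ₀) {d₀ : ℝ} (hd₀ : 1 ≤ d₀) (Dmax : ℕ)
    {n : ℤ × ℤ × ℤ} (hn : n ∈ Nrange N) (hg : goodCube V T N n) :
    ∑ q ∈ Icc 1 ⌊d₀⌋₊, wt Δ₀ Dmax d₀ q * Ustar (Fprim X τ m w) (LC (T / N) n) q ≤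
      4 * (1 + Real.log Q₀) / Δ₀ * (Q₀ : ℝ) ^ 3 *
          (2 * ((Q₀ : ℝ) ^ 4 * Q₁ ^ 2 * ((d : ℝ) ^ 3 * (C₁ * V * Real.exp (-(c₁ * Real.sqrt (Real.log (hbL X τ)))))) ^ 2 +
            162 * (C₃ * (T / N) ^ 3 * Real.log (T / N) ^ e₃) ^ (2 / 3 : ℝ) *
              (2 * (T / N) ^ 2 / (Q₁ / Q₀) + 2 * (T / N) * (1 + Real.log ((⌊3 * T⌋₊ + 1 : ℕ) : ℝ)) + ((⌊3 * T⌋₊ + 1 : ℕ) : ℝ)) ^ 2)) +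
        414720 * (1 + Real.log (2 * d₀)) / Δ₀ *
          ((T / N + 1) ^ 3 / Q₀ + d₀ * (T / N + 1) ^ 2 + d₀ ^ 3) * (81 * (C₂ * (T / N) ^ 3 * Real.log (T / N) ^ e₂)) := by
  classical
  set s : ℝ := T / N with hs
  have hs0 : 0 ≤ s := by linarith
  have hlog : 0 ≤ Real.log s := Real.log_nonneg (by linarith)
  have hQR : (0 : ℝ) < Q₀ := by exact_mod_cast hQ₀
  have hG1 : 1 ≤ Q₁ / Q₀ := by rw [le_div_iff₀ hQR]; linarith
  -- hypotheses of `sum_wt_Ustar_le`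
  have hcube := cubeCond_of_goodCube hT hTV hg
  have hC0 : ∀ v ∈ latticeCube (corner s n) s, v ≠ 0 := fun v hv => (hcf3_le_of_goodCube hT hTV hN hg hv).1
  have hM : ∀ v ∈ latticeCube (corner s n) s, hcf3 v ≤ ⌊3 * T⌋₊ + 1 := fun v hv => (hcf3_le_of_goodCube hT hTV hN hg hv).2
  have h := sum_wt_Ustar_le hX hτ hτ1 hm hd hHyp hw1 hwper (by rw [← hTV]; positivity) hs0 hsL hcube hC0 hM hQ₀ hQ₀₁ hΔ hd₀ Dmax
  rw [LC]
  refine h.trans ?_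
  -- the per-hypercube divisor sums
  obtain ⟨c1, c2, c3⟩ := abs_corner_le hs0 hn
  have hc3 : s * (3 * N + 2) ≤ s ^ 3 := by
    calc s * (3 * N + 2) ≤ s * s ^ 2 := mul_le_mul_of_nonneg_left hsN hs0
      _ = s ^ 3 := by ring
  have hS3 : ∑ v ∈ latticeCube (corner s n) s, (idealDivisorCount (Ideal.span {coordElt v}) : ℝ) ^ 3 ≤
      C₃ * s ^ 3 * Real.log s ^ e₃ := h45₃ _ _ hs2 (c1.trans hc3) (c2.trans hc3) (c3.trans hc3)
  have hF2 : ∑ v ∈ latticeCube (corner s n) s, Fprim X τ m w v ^ 2 ≤ 81 * (C₂ * s ^ 3 * Real.log s ^ e₂) := by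
    calc ∑ v ∈ latticeCube (corner s n) s, Fprim X τ m w v ^ 2
        ≤ ∑ v ∈ latticeCube (corner s n) s, 81 * (idealDivisorCount (Ideal.span {coordElt v}) : ℝ) ^ 2 := by
          refine sum_le_sum fun v _ => ?_
          have h1 := abs_Fprim_le hw1 hX hτ hτ1 hm v
          rw [tauK] at h1
          have h0 : 0 ≤ (idealDivisorCount (Ideal.span {coordElt v}) : ℝ) := Nat.cast_nonneg _
          nlinarith [abs_nonneg (Fprim X τ m w v), sq_abs (Fprim X τ m w v)]
      _ = 81 * ∑ v ∈ latticeCube (corner s n) s, (idealDivisorCount (Ideal.span {coordElt v}) : ℝ) ^ 2 := by rw [mul_sum]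
      _ ≤ 81 * (C₂ * s ^ 3 * Real.log s ^ e₂) := by
          gcongr; exact h45₂ _ _ hs2 (c1.trans hc3) (c2.trans hc3) (c3.trans hc3)
  -- monotonicity in the two sums, `R` and `N'`
  have hR := sum_Ioc_sq_le hG1 hs0 (⌊3 * T⌋₊ + 1)
  have hR0 : 0 ≤ ∑ g ∈ Ioc ⌊Q₁ / Q₀⌋₊ (⌊3 * T⌋₊ + 1), (s / g + 1) ^ 2 := sum_nonneg fun g _ => by positivity
  have hN' : (((⌊s⌋₊ + 1 : ℕ) : ℝ)) ≤ s + 1 := by push_cast; linarith [Nat.floor_le hs0]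
  have hN'0 : (0 : ℝ) ≤ ((⌊s⌋₊ + 1 : ℕ) : ℝ) := by positivity
  have hS30 : 0 ≤ ∑ v ∈ latticeCube (corner s n) s, (idealDivisorCount (Ideal.span {coordElt v}) : ℝ) ^ 3 :=
    sum_nonneg fun v _ => by positivity
  have hrpow : ((∑ v ∈ latticeCube (corner s n) s, (idealDivisorCount (Ideal.span {coordElt v}) : ℝ) ^ 3) ^ (1 / 3 : ℝ)) ^ 2 ≤
      (C₃ * s ^ 3 * Real.log s ^ e₃) ^ (2 / 3 : ℝ) := by
    have e : ((∑ v ∈ latticeCube (corner s n) s, (idealDivisorCount (Ideal.span {coordElt v}) : ℝ) ^ 3) ^ (1 / 3 : ℝ)) ^ 2 =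
        (∑ v ∈ latticeCube (corner s n) s, (idealDivisorCount (Ideal.span {coordElt v}) : ℝ) ^ 3) ^ (2 / 3 : ℝ) := by
      rw [← Real.rpow_natCast, ← Real.rpow_mul hS30]; norm_num
    rw [e]
    exact Real.rpow_le_rpow hS30 hS3 (by norm_num)
  have hH0 : 0 ≤ ((d : ℝ) ^ 3 * (C₁ * V * Real.exp (-(c₁ * Real.sqrt (Real.log (hbL X τ)))))) ^ 2 := sq_nonneg _
  have hlogQ : 0 ≤ Real.log Q₀ := Real.log_nonneg (by exact_mod_cast hQ₀)
  have hlogd : 0 ≤ Real.log (2 * d₀) := Real.log_nonneg (by linarith)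
  have hC3r : 0 ≤ (C₃ * s ^ 3 * Real.log s ^ e₃) ^ (2 / 3 : ℝ) := Real.rpow_nonneg (mul_nonneg (by positivity) (pow_nonneg hlog _)) _
  gcongr

/-! ### The bound for `S₄⁺` -/

open scoped Classical in
/-- **The bound for `|S₄⁺|`**: Class I cells (Möbius, characters, weights, large sieve, (3.14), tail) and
Class II cells (Lemma 11.1 and the count of Class II hypercubes). All constants explicit in terms of those
of Lemma 4.5 (`C₂, e₂, C₃, e₃`), Lemma 11.1 (`C₁₁, E, κ`) and (3.14) (`C₁, c₁`).
[cite: HeathBrownActa2001, Lemma 12.2] -/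
theorem abs_S4plus_le (hX : 1 < X) (hη0 : 0 ≤ η) (hη1 : η ≤ 1) (hτ : 0 < τ) (hτ1 : τ ≤ 1) {nn : ℕ}
    {m : Fin (nn + 1) → ℕ} (hm : CoreAdmissible τ m) {Q₁ C₁ c₁ : ℝ} {d : ℕ} (hd : 0 < d)
    (hHyp : Hyp314 X τ m ((d : ℝ) * Q₁) C₁ c₁ 3 1)
    (hw1 : ∀ b, |w b| ≤ 1) (hwper : ∀ b u, DvdVec (d : ℤ) u → w (b + u) = w b)
    (hT : 0 < T) (hTV : T ^ 3 = V) (hN : 1248 ≤ N) (hs2 : 2 ≤ T / N) (hsN : 3 * (N : ℝ) + 2 ≤ (T / N) ^ 2)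
    (hsL : hbL X τ ^ 2 ≤ T / N) (hVX : X ≤ 270 * V)
    {C₂ C₃ C₁₁ κ : ℝ} {e₂ e₃ E : ℕ} (hC₂ : 0 < C₂) (hC₃ : 0 < C₃) (hC₁₁ : 0 < C₁₁)
    (h45₂ : ∀ (a : ℝ × ℝ × ℝ) (S₀ : ℝ), 2 ≤ S₀ → |a.1| ≤ S₀ ^ 3 → |a.2.1| ≤ S₀ ^ 3 → |a.2.2| ≤ S₀ ^ 3 →
      ∑ v ∈ latticeCube a S₀, (idealDivisorCount (Ideal.span {coordElt v}) : ℝ) ^ 2 ≤ C₂ * S₀ ^ 3 * Real.log S₀ ^ e₂)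
    (h45₃ : ∀ (a : ℝ × ℝ × ℝ) (S₀ : ℝ), 2 ≤ S₀ → |a.1| ≤ S₀ ^ 3 → |a.2.1| ≤ S₀ ^ 3 → |a.2.2| ≤ S₀ ^ 3 →
      ∑ v ∈ latticeCube a S₀, (idealDivisorCount (Ideal.span {coordElt v}) : ℝ) ^ 3 ≤ C₃ * S₀ ^ 3 * Real.log S₀ ^ e₃)
    (h11 : ∀ (a₁ a₂ : ℝ × ℝ × ℝ) (S₀ : ℝ), 2 ≤ S₀ →
      |a₁.1| ≤ S₀ ^ 3 → |a₁.2.1| ≤ S₀ ^ 3 → |a₁.2.2| ≤ S₀ ^ 3 →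
        ∀ D : ℕ, 1 ≤ D → (D : ℝ) ≤ κ * S₀ →
          ∑ b ∈ (latticeCube a₁ S₀).filter IsPrimitiveVec,
              ∑ _x ∈ (latticeCube a₂ S₀).filter (fun x => DvdVec (D : ℤ) (cross3 b x)),
                (idealDivisorCount (Ideal.span {coordElt b}) : ℝ) ^ 2 ≤
            C₁₁ * S₀ ^ 6 / (D : ℝ) ^ 2 * Real.log S₀ ^ E)
    (hκs : 270 * V / X ≤ κ * (T / N))
    {Q₀ : ℕ} (hQ₀ : 1 ≤ Q₀) (hQ₀₁ : (Q₀ : ℝ) ≤ Q₁) {Δ₀ : ℝ} (hΔ1 : 1 ≤ Δ₀) (hΔD : Δ₀ ≤ 270 * V / X)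
    {d₀ : ℝ} (hd₀ : 1 ≤ d₀) :
    |S4plus X η τ m V T w Δ₀| ≤
      (6 * (N : ℝ) + 3) ^ 6 *
        (4 * (1 + Real.log Q₀) / Δ₀ * (Q₀ : ℝ) ^ 3 *
          (2 * ((Q₀ : ℝ) ^ 4 * Q₁ ^ 2 * ((d : ℝ) ^ 3 * (C₁ * V * Real.exp (-(c₁ * Real.sqrt (Real.log (hbL X τ)))))) ^ 2 +
            162 * (C₃ * (T / N) ^ 3 * Real.log (T / N) ^ e₃) ^ (2 / 3 : ℝ) *
              (2 * (T / N) ^ 2 / (Q₁ / Q₀) + 2 * (T / N) * (1 + Real.log ((⌊3 * T⌋₊ + 1 : ℕ) : ℝ)) + ((⌊3 * T⌋₊ + 1 : ℕ) : ℝ)) ^ 2)) +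
        414720 * (1 + Real.log (2 * d₀)) / Δ₀ *
          ((T / N + 1) ^ 3 / Q₀ + d₀ * (T / N + 1) ^ 2 + d₀ ^ 3) * (81 * (C₂ * (T / N) ^ 3 * Real.log (T / N) ^ e₂))) +
      81 * TL T d₀ +
      ((N : ℝ) * (Real.log (270 * V / X) - Real.log Δ₀) + 2) * (34000000000 * (6 * (N : ℝ) + 3) ^ 5) *
        (81 * (C₁₁ * (T / N) ^ 6 * Real.log (T / N) ^ E * (2 / (N * Δ₀) + 3 / Δ₀ ^ 2))) := by
  classical
  have hX0 : 0 < X := by linarith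
  have hN0 : 0 < N := by omega
  have hΔ0 : 0 < Δ₀ := by linarith
  have hd0 : 0 ≤ d₀ := by linarith
  rw [S4plus_eq_classI_add_classII hX0 hη1 hT hTV hN0 hΔ1]
  refine (abs_add_le _ _).trans ?_
  have hII := sum_classII_abs_S5_le (w := w) (Δ₀ := Δ₀) hw1 hX hη0 hη1 hτ hτ1 hm hT hTV hN hC₁₁ h11 hs2 hsN hκs hΔ1 hΔD
  have hI := sum_abs_classISum_le (η := η) (w := w) (Δ₀ := Δ₀) hw1 hX hτ hτ1 hm hT hTV hN0 hVX hd0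
  refine add_le_add ((abs_sum_le_sum_abs _ _).trans (hI.trans (add_le_add ?_ le_rfl))) ((abs_sum_le_sum_abs _ _).trans hII)
  -- the Class I main part: `#Nrange · ∑_{good} A_n ≤ (6N+3)⁶ · Abound`
  set GN := (Nrange N).filter (fun n => goodCube V T N n) with hGN
  set Ab : ℝ := 4 * (1 + Real.log Q₀) / Δ₀ * (Q₀ : ℝ) ^ 3 *
          (2 * ((Q₀ : ℝ) ^ 4 * Q₁ ^ 2 * ((d : ℝ) ^ 3 * (C₁ * V * Real.exp (-(c₁ * Real.sqrt (Real.log (hbL X τ)))))) ^ 2 +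
            162 * (C₃ * (T / N) ^ 3 * Real.log (T / N) ^ e₃) ^ (2 / 3 : ℝ) *
              (2 * (T / N) ^ 2 / (Q₁ / Q₀) + 2 * (T / N) * (1 + Real.log ((⌊3 * T⌋₊ + 1 : ℕ) : ℝ)) + ((⌊3 * T⌋₊ + 1 : ℕ) : ℝ)) ^ 2)) +
        414720 * (1 + Real.log (2 * d₀)) / Δ₀ *
          ((T / N + 1) ^ 3 / Q₀ + d₀ * (T / N + 1) ^ 2 + d₀ ^ 3) * (81 * (C₂ * (T / N) ^ 3 * Real.log (T / N) ^ e₂)) with hAb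
  have hAn : ∀ n ∈ GN, ∑ q ∈ Icc 1 ⌊d₀⌋₊, wt Δ₀ ⌊810 * V / X⌋₊ d₀ q * Ustar (Fprim X τ m w) (LC (T / N) n) q ≤ Ab := by
    intro n hn
    rw [hGN, mem_filter] at hn
    exact sum_wt_Ustar_good_le hX hτ hτ1 hm hd hHyp hw1 hwper hT hTV hN0 hs2 hsN hsL hC₃ h45₂ h45₃ hQ₀ hQ₀₁ hΔ0 hd₀ _ hn.1 hn.2
  have hA0 : ∀ n, 0 ≤ ∑ q ∈ Icc 1 ⌊d₀⌋₊, wt Δ₀ ⌊810 * V / X⌋₊ d₀ q * Ustar (Fprim X τ m w) (LC (T / N) n) q :=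
    fun n => sum_nonneg fun q _ => mul_nonneg (wt_nonneg _ _ _ _) (Ustar_nonneg _ _ _)
  have hAb0 : 0 ≤ Ab := by
    have hlog : 0 ≤ Real.log (T / N) := Real.log_nonneg (by linarith)
    have hlogQ : 0 ≤ Real.log Q₀ := Real.log_nonneg (by exact_mod_cast hQ₀)
    have hlogd : 0 ≤ Real.log (2 * d₀) := Real.log_nonneg (by linarith)
    have hlog3 : 0 ≤ Real.log ((⌊3 * T⌋₊ + 1 : ℕ) : ℝ) := by
      apply Real.log_nonneg
      have : (1 : ℝ) ≤ ((⌊3 * T⌋₊ + 1 : ℕ) : ℝ) := by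
        have h0 : (0 : ℝ) ≤ (⌊3 * T⌋₊ : ℝ) := Nat.cast_nonneg _
        push_cast; linarith
      exact this
    have hs0 : 0 ≤ T / N := by linarith
    have hQR : (0:ℝ) < Q₀ := by exact_mod_cast hQ₀
    have hQQ : 0 < Q₁ / Q₀ := div_pos (lt_of_lt_of_le hQR hQ₀₁) hQR
    have h1 : 0 ≤ (C₃ * (T / N) ^ 3 * Real.log (T / N) ^ e₃) ^ (2 / 3 : ℝ) :=
      Real.rpow_nonneg (mul_nonneg (by positivity) (pow_nonneg hlog _)) _
    have h2 : 0 ≤ Real.log (T / N) ^ e₂ := pow_nonneg hlog _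
    have h3 : 0 ≤ ((d : ℝ) ^ 3 * (C₁ * V * Real.exp (-(c₁ * Real.sqrt (Real.log (hbL X τ)))))) ^ 2 := sq_nonneg _
    rw [hAb]
    positivity
  calc (#(Nrange N) : ℝ) * ∑ n ∈ GN, ∑ q ∈ Icc 1 ⌊d₀⌋₊, wt Δ₀ ⌊810 * V / X⌋₊ d₀ q * Ustar (Fprim X τ m w) (LC (T / N) n) q
      ≤ #(Nrange N) * ∑ _n ∈ GN, Ab := by
        gcongr with n hn
        exact hAn n hn
    _ = #(Nrange N) * (#GN * Ab) := by rw [sum_const, nsmul_eq_mul]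
    _ ≤ (6 * (N : ℝ) + 3) ^ 3 * ((6 * (N : ℝ) + 3) ^ 3 * Ab) := by
        have h1 := card_Nrange_le N
        have h2 : (#GN : ℝ) ≤ (6 * (N : ℝ) + 3) ^ 3 := le_trans (by exact_mod_cast card_le_card (filter_subset _ _)) h1
        gcongr
    _ = (6 * (N : ℝ) + 3) ^ 6 * Ab := by ring


end Literature.NumberTheory.Sieve.CubicSieve.Twisted

end
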